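import Literature.NumberTheory.CubicFields.ThreeTorsionParametrizationTheta
import Mathlib.NumberTheory.NumberField.Basic
import Mathlib.RingTheory.ClassGroup.Basic
import Mathlib.RingTheory.DedekindDomain.IntegralClosure
import HarnessLib

/-!
# The `𝓞_K`-ideal `I = (θ₁, θ₂)` of an integer-matrix binary cubic form (the extension to `𝓞 K` of Bhargava's `S`-ideal `ℤθ₁ + ℤθ₂`): `I³ = (θ₁θ₂)`, a 3-torsion ideal class (Bhargava, HCL I, Thm 13; Bhargava–Varma, Thm 9)

Topic `Literature/NumberTheory/CubicFields`, continuing `ThreeTorsionParametrizationTheta.lean`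
(`θᵢ = (gᵢ + aᵢ√D)/2`, `θ₀θ₂ = θ₁²`, `θ₁θ₃ = θ₂²`, the system (21) with `α = θ₁, β = θ₂,
δ = θ₁θ₂`, `SL₂(ℤ)`-equivariance). Third step of the class-field-theory-free road to the
Davenport–Heilbronn theorem on `Cl(K)[3]` (Bhargava–Varma 2016, §§2–3).

Bhargava, HCL I, Thm 13: "a canonical bijection between the set of nondegenerate `SL₂(ℤ)`-orbits
on the space `Sym³ℤ²` of binary cubic forms, and the set of equivalence classes of triples
`(S, I, δ)`, where `S` is a nondegenerate oriented quadratic ring, `I` is an ideal of `S`, and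
`δ` is an invertible element of `S ⊗ ℚ` such that `I³ ⊆ δ·S` and `N(I)³ = N(δ)`"; Bhargava–Varma
§2.2: for projective (e.g. all, when `S` is maximal) triples "we have `I³ = (δ)`", and the
forgetful map `(𝒪, I, δ) ↦ [I] ∈ Cl₃(𝒪)` of Lemma 13 / HCL I Cor. 14–15. CAVEAT ON THE SETTING:
Bhargava's `I = ℤθ₁ + ℤθ₂` is an ideal of the ORDER `S = ℤ[τ]` of discriminant `D = disc C`;
this file works instead in the maximal order `𝓞 K` of `K = ℚ(√D)` with the EXTENDED ideal
`I·𝓞 K = (θ₁, θ₂)`, which coincides with Bhargava's `I` exactly when `S = 𝓞 K`, i.e. when `D` is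
a fundamental discriminant (the only case used downstream: 3-torsion in class groups of quadratic
FIELDS). The statements `I³ = (δ)`, `[I]³ = 1` below are about the extended ideal in `𝓞 K` (true
as proved for every projective `C`; they are BV's statements verbatim only for fundamental `D`).
This file constructs, for an integral integer-matrix form `C` and a number field `K ∋ s` with
`s² = D = disc C`, `D ≡ ε (mod 4)`, `ε ∈ {0, 1}`:

* `isIntegral_thetaForm` — the `θᵢ` are algebraic integers (`θᵢ = cᵢ + aᵢτ`, `τ = (ε + s)/2`,
  integrality of `cᵢ` from the parity lemma of `IntegerMatrixForms`);
* `cubicIdeal C s` — **the ideal `(θ₁, θ₂)` of `𝓞 K`**, the extension to `𝓞 K` of Bhargava's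
  `S`-ideal `ℤθ₁ + ℤθ₂` (HCL I (23): `α : β = θ₁ : θ₂`; equal to it when `disc C` is fundamental),
  and `deltaIdeal C s = (θ₁θ₂)` (`δ = αβ` for this representative);
* `cubicIdeal_pow_three` — **`(θ₁, θ₂)³ = (δ)` in `𝓞 K`** when the Hessian `(A, B, C)` is
  primitive (BV (9): "`f` is projective ⟺ `(b² − ac, ad − bc, c² − bd) = 1`"; for fundamental
  `D` the Hessian is always primitive — a separate, elementary lemma, proved downstream where it
  is used): `I³ = δ · (θ₀, θ₁, θ₂, θ₃)` by (21), and `(θ₀, θ₁, θ₂, θ₃) = 𝓞 K` because it contains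
  the integers `A², AB, B², C²` (`intCast_mem_thetaSpan`);
* `mk0_cubicIdeal_pow_three` — hence **`[(θ₁, θ₂)]³ = 1` in `Cl(𝓞 K)`**: the form `C` of
  discriminant `D` produces a 3-torsion ideal class of `K = ℚ(√D)` (for fundamental `D` this is
  BV Lemma 13's map `H(𝒪) → Cl₃(𝒪)`, `𝒪 = 𝓞 K`).

All statements are proved. NOT here (planned sequel files): that the class depends only on the
`SL₂(ℤ)`-orbit of `C`, injectivity on orbits and surjectivity onto pairs `(I, δ)` for fundamental
`D` (the uniqueness half of Thm 13), the unit index `|U/U³|` (BV Lemma 13, Cor. 14) and the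
reducible forms (BV Lemma 16–Cor. 18).

## References

* M. Bhargava, *Higher composition laws I*, Ann. of Math. 159 (2004), §3.4, Thm 13 and its proof,
  Cor. 14–15 [Bhargava2004HCL1].
* M. Bhargava, I. Varma, *The mean number of 3-torsion elements in the class groups and ideal
  groups of quadratic orders*, Proc. LMS 112 (2016) = arXiv:1401.5875, Thm 9, §2.2 (Lemma 13,
  Cor. 14), §2.3 (9) [BhargavaVarma2016].
-/

namespace Literature.NumberTheory.CubicFields

open NumberField
open scoped NumberField nonZeroDivisors

namespace SymCubic

variable {K : Type*} [Field K] [CharZero K]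

/-! ### Integrality of the `θᵢ` -/

/-- `τ = (ε + s)/2` is an algebraic integer when `s² = D`, `ε ∈ {0,1}` and `4 ∣ D − ε`: it is a
root of `X² − εX − (D − ε)/4` (the generator of the quadratic ring `S(D) = ℤ[τ]`, HCL I §2.1 /
BV §2.1). [folklore] -/
theorem isIntegral_tau {D ε : ℤ} {s : K} (hs : s ^ 2 = (D : K)) (hε : ε = 0 ∨ ε = 1)
    (h4 : (4 : ℤ) ∣ D - ε) : IsIntegral ℤ (((ε : K) + s) / 2) := by
  obtain ⟨m, hm⟩ := h4
  have hε2 : (ε : K) ^ 2 = ε := by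
    rcases hε with rfl | rfl <;> norm_num
  have hDK : (D : K) = 4 * (m : K) + (ε : K) := by
    have : D = 4 * m + ε := by linarith
    rw [this]
    push_cast
    ring
  refine ⟨Polynomial.X ^ 2 + (Polynomial.C (-ε) * Polynomial.X + Polynomial.C (-m)), ?_, ?_⟩
  · refine (Polynomial.monic_X_pow 2).add_of_left (lt_of_le_of_lt Polynomial.degree_linear_le ?_)
    rw [Polynomial.degree_X_pow]
    exact_mod_cast (by norm_num : (1 : ℕ) < 2)
  · simp only [Polynomial.eval₂_add, Polynomial.eval₂_mul, Polynomial.eval₂_pow, Polynomial.eval₂_X,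
      Polynomial.eval₂_C, algebraMap_int_eq, Int.coe_castRingHom, Int.cast_neg]
    rw [show ((((ε : K) + s) / 2) ^ 2 : K) = ((ε : K) ^ 2 + 2 * ε * s + s ^ 2) / 4 by ring, hs, hDK]
    linear_combination (-(1 : K) / 4) * hε2

/-- `(g + a·s)/2` is an algebraic integer when `2 ∣ g − εa` (it is `(g − εa)/2 + a·τ`). [folklore] -/
theorem isIntegral_half_add {D ε : ℤ} {s : K} (hs : s ^ 2 = (D : K)) (hε : ε = 0 ∨ ε = 1)
    (h4 : (4 : ℤ) ∣ D - ε) {g a : ℤ} (h2 : (2 : ℤ) ∣ g - ε * a) :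
    IsIntegral ℤ (((g : K) + (a : K) * s) / 2) := by
  obtain ⟨c, hc⟩ := h2
  have heq : ((g : K) + (a : K) * s) / 2 = (c : K) + (a : K) * (((ε : K) + s) / 2) := by
    have : (g : K) = 2 * c + ε * a := by
      have : g = 2 * c + ε * a := by linarith
      exact_mod_cast this
    rw [this]
    ring
  rw [heq]
  exact IsIntegral.add isIntegral_algebraMap (IsIntegral.mul isIntegral_algebraMap (isIntegral_tau hs hε h4))

section Setup

variable (C : SymCubic ℤ) {ε : ℤ} (hε : ε = 0 ∨ ε = 1) (h4 : (4 : ℤ) ∣ C.disc - ε)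
include hε h4

/-- From `gᵢ ≡ D aᵢ (mod 2)` (`IntegerMatrixForms`) and `D ≡ ε (mod 2)`: `2 ∣ gᵢ − ε aᵢ` for all
four `i` — Bhargava's `cᵢ ∈ ℤ`. [cite: Bhargava2004HCL1, §3.4 (proof of Theorem 13, integrality of the cᵢ)] -/
theorem two_dvd_gCov_sub :
    (2 : ℤ) ∣ C.gCov.a₀ - ε * C.a₀ ∧ (2 : ℤ) ∣ C.gCov.a₁ - ε * C.a₁ ∧
      (2 : ℤ) ∣ C.gCov.a₂ - ε * C.a₂ ∧ (2 : ℤ) ∣ C.gCov.a₃ - ε * C.a₃ := by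
  obtain ⟨h0, h1, h2, h3⟩ := two_dvd_gCov_add_disc_mul C
  have hD : (2 : ℤ) ∣ C.disc + ε := by
    obtain ⟨m, hm⟩ := h4
    exact ⟨2 * m + ε, by rcases hε with rfl | rfl <;> omega⟩
  refine ⟨?_, ?_, ?_, ?_⟩
  · have : C.gCov.a₀ - ε * C.a₀ = (C.gCov.a₀ + C.disc * C.a₀) - (C.disc + ε) * C.a₀ := by ring
    rw [this]; exact dvd_sub h0 (hD.mul_right _)
  · have : C.gCov.a₁ - ε * C.a₁ = (C.gCov.a₁ + C.disc * C.a₁) - (C.disc + ε) * C.a₁ := by ring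
    rw [this]; exact dvd_sub h1 (hD.mul_right _)
  · have : C.gCov.a₂ - ε * C.a₂ = (C.gCov.a₂ + C.disc * C.a₂) - (C.disc + ε) * C.a₂ := by ring
    rw [this]; exact dvd_sub h2 (hD.mul_right _)
  · have : C.gCov.a₃ - ε * C.a₃ = (C.gCov.a₃ + C.disc * C.a₃) - (C.disc + ε) * C.a₃ := by ring
    rw [this]; exact dvd_sub h3 (hD.mul_right _)

/-- **The `θᵢ` are algebraic integers** (`θᵢ = cᵢ + aᵢτ ∈ ℤ[τ] ⊆ 𝓞_K`). [cite: Bhargava2004HCL1, §3.4 (proof of Theorem 13, eq. (21) in the ring S)] -/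
theorem isIntegral_thetaForm {s : K} (hs : s ^ 2 = (C.disc : K)) :
    IsIntegral ℤ (C.thetaForm s).a₀ ∧ IsIntegral ℤ (C.thetaForm s).a₁ ∧
      IsIntegral ℤ (C.thetaForm s).a₂ ∧ IsIntegral ℤ (C.thetaForm s).a₃ := by
  obtain ⟨h0, h1, h2, h3⟩ := two_dvd_gCov_sub C hε h4
  exact ⟨isIntegral_half_add hs hε h4 h0, isIntegral_half_add hs hε h4 h1,
    isIntegral_half_add hs hε h4 h2, isIntegral_half_add hs hε h4 h3⟩

end Setup

/-! ### The integers `A², AB, B², C²` as combinations of the `θᵢ` -/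

section IntegerCombinations

variable (C : SymCubic ℤ) (s : K)

/-- `a₀θ₁ − a₁θ₀ = −A²`. [folklore] -/
theorem a₀_mul_theta₁_sub : (C.a₀ : K) * (C.thetaForm s).a₁ - (C.a₁ : K) * (C.thetaForm s).a₀
    = -((C.hess.1 : K) ^ 2) := by
  simp only [thetaForm_a₀, thetaForm_a₁, hess, gCov]
  push_cast
  ring

/-- `a₀θ₂ − a₂θ₀ = AB`. [folklore] -/
theorem a₀_mul_theta₂_sub : (C.a₀ : K) * (C.thetaForm s).a₂ - (C.a₂ : K) * (C.thetaForm s).a₀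
    = (C.hess.1 : K) * (C.hess.2.1 : K) := by
  simp only [thetaForm_a₀, thetaForm_a₂, hess, gCov]
  push_cast
  ring

/-- `a₀θ₃ − a₃θ₀ = AC − B²`. [folklore] -/
theorem a₀_mul_theta₃_sub : (C.a₀ : K) * (C.thetaForm s).a₃ - (C.a₃ : K) * (C.thetaForm s).a₀
    = (C.hess.1 : K) * (C.hess.2.2 : K) - (C.hess.2.1 : K) ^ 2 := by
  simp only [thetaForm_a₀, thetaForm_a₃, hess, gCov]
  push_cast
  ring

/-- `a₁θ₂ − a₂θ₁ = −AC`. [folklore] -/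
theorem a₁_mul_theta₂_sub : (C.a₁ : K) * (C.thetaForm s).a₂ - (C.a₂ : K) * (C.thetaForm s).a₁
    = -((C.hess.1 : K) * (C.hess.2.2 : K)) := by
  simp only [thetaForm_a₁, thetaForm_a₂, hess, gCov]
  push_cast
  ring

/-- `a₂θ₃ − a₃θ₂ = −C²`. [folklore] -/
theorem a₂_mul_theta₃_sub : (C.a₂ : K) * (C.thetaForm s).a₃ - (C.a₃ : K) * (C.thetaForm s).a₂
    = -((C.hess.2.2 : K) ^ 2) := by
  simp only [thetaForm_a₂, thetaForm_a₃, hess, gCov]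
  push_cast
  ring

end IntegerCombinations

/-! ### The ideals `I = (θ₁, θ₂)` and `(δ) = (θ₁θ₂)` of `𝓞 K` -/

/-- **The ideal `I(C) = (θ₁, θ₂)` of `𝓞 K`** attached to `C`: the EXTENSION to the maximal order
`𝓞 K` of Bhargava's `S`-ideal `I = ℤθ₁ + ℤθ₂` of the order `S = ℤ[τ]` of discriminant `disc C`
(HCL I (23): "`α : β = (c₁ + a₁τ) : (c₂ + a₂τ)`", representative `α = θ₁`, `β = θ₂`; by (20), (24)
`ℤθ₁ + ℤθ₂` is an `S`-ideal). The two coincide exactly when `S = 𝓞 K`, i.e. when `disc C` is a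
fundamental discriminant — the case of the applications. Defined for every `s ∈ K` as the ideal
generated by the algebraic integers among `θ₁, θ₂` (both are, `isIntegral_thetaForm`, under the
standing hypotheses). [cite: Bhargava2004HCL1, §3.4 (proof of Theorem 13, eq. (23)); extended to 𝓞 K] -/
noncomputable def cubicIdeal (C : SymCubic ℤ) (s : K) : Ideal (𝓞 K) :=
  Ideal.span {x | (x : K) = (C.thetaForm s).a₁ ∨ (x : K) = (C.thetaForm s).a₂}

/-- The principal ideal `(δ) = (θ₁θ₂)` (`δ = αβ` for the representative `(α, β) = (θ₁, θ₂)`, since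
`α²β = δθ₁`). [cite: Bhargava2004HCL1, §3.4 (proof of Theorem 13, δ determined by (21))] -/
noncomputable def deltaIdeal (C : SymCubic ℤ) (s : K) : Ideal (𝓞 K) :=
  Ideal.span {x | (x : K) = (C.thetaForm s).a₁ * (C.thetaForm s).a₂}

/-- The ideal `J = (θ₀, θ₁, θ₂, θ₃)` (the image of `I³/δ`; it is `𝓞 K` for projective `C`). [folklore] -/
noncomputable def thetaSpan (C : SymCubic ℤ) (s : K) : Ideal (𝓞 K) :=
  Ideal.span {x | (x : K) = (C.thetaForm s).a₀ ∨ (x : K) = (C.thetaForm s).a₁ ∨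
    (x : K) = (C.thetaForm s).a₂ ∨ (x : K) = (C.thetaForm s).a₃}

section Representatives

omit [CharZero K]
variable (C : SymCubic ℤ) {s : K}

/-- With integral representatives `tᵢ`: `I = (t₁, t₂)`. [folklore] -/
theorem cubicIdeal_eq_span {t₁ t₂ : 𝓞 K} (ht₁ : (t₁ : K) = (C.thetaForm s).a₁)
    (ht₂ : (t₂ : K) = (C.thetaForm s).a₂) : C.cubicIdeal s = Ideal.span {t₁, t₂} := by
  unfold cubicIdeal
  congr 1
  ext x
  simp only [Set.mem_setOf_eq, Set.mem_insert_iff, Set.mem_singleton_iff]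
  rw [← ht₁, ← ht₂]
  constructor
  · rintro (h | h)
    · exact Or.inl (RingOfIntegers.ext h)
    · exact Or.inr (RingOfIntegers.ext h)
  · rintro (rfl | rfl)
    · exact Or.inl rfl
    · exact Or.inr rfl

/-- With integral representatives: `(δ) = (t₁t₂)`. [folklore] -/
theorem deltaIdeal_eq_span {t₁ t₂ : 𝓞 K} (ht₁ : (t₁ : K) = (C.thetaForm s).a₁)
    (ht₂ : (t₂ : K) = (C.thetaForm s).a₂) : C.deltaIdeal s = Ideal.span {t₁ * t₂} := by
  unfold deltaIdeal
  congr 1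
  ext x
  simp only [Set.mem_setOf_eq, Set.mem_singleton_iff]
  rw [← ht₁, ← ht₂, ← map_mul]
  exact ⟨fun h => RingOfIntegers.ext h, fun h => h ▸ rfl⟩

/-- With integral representatives: `J = (t₀, t₁, t₂, t₃)`. [folklore] -/
theorem thetaSpan_eq_span {t₀ t₁ t₂ t₃ : 𝓞 K} (ht₀ : (t₀ : K) = (C.thetaForm s).a₀)
    (ht₁ : (t₁ : K) = (C.thetaForm s).a₁) (ht₂ : (t₂ : K) = (C.thetaForm s).a₂)
    (ht₃ : (t₃ : K) = (C.thetaForm s).a₃) : C.thetaSpan s = Ideal.span {t₀, t₁, t₂, t₃} := by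
  unfold thetaSpan
  congr 1
  ext x
  simp only [Set.mem_setOf_eq, Set.mem_insert_iff, Set.mem_singleton_iff]
  rw [← ht₀, ← ht₁, ← ht₂, ← ht₃]
  constructor
  · rintro (h | h | h | h)
    · exact Or.inl (RingOfIntegers.ext h)
    · exact Or.inr (Or.inl (RingOfIntegers.ext h))
    · exact Or.inr (Or.inr (Or.inl (RingOfIntegers.ext h)))
    · exact Or.inr (Or.inr (Or.inr (RingOfIntegers.ext h)))
  · rintro (rfl | rfl | rfl | rfl)
    · exact Or.inl rfl
    · exact Or.inr (Or.inl rfl)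
    · exact Or.inr (Or.inr (Or.inl rfl))
    · exact Or.inr (Or.inr (Or.inr rfl))

end Representatives

section Main

variable (C : SymCubic ℤ) {s : K} {ε : ℤ} (hs : s ^ 2 = (C.disc : K))
  (hε : ε = 0 ∨ ε = 1) (h4 : (4 : ℤ) ∣ C.disc - ε)
include hs hε h4

/-- The four algebraic integers `θᵢ` as elements of `𝓞 K`. [folklore] -/
theorem exists_ringOfIntegers_thetaForm :
    ∃ t₀ t₁ t₂ t₃ : 𝓞 K, (t₀ : K) = (C.thetaForm s).a₀ ∧ (t₁ : K) = (C.thetaForm s).a₁ ∧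
      (t₂ : K) = (C.thetaForm s).a₂ ∧ (t₃ : K) = (C.thetaForm s).a₃ := by
  obtain ⟨h0, h1, h2, h3⟩ := isIntegral_thetaForm C hε h4 hs
  exact ⟨⟨_, (mem_integralClosure_iff ℤ K).mpr h0⟩, ⟨_, (mem_integralClosure_iff ℤ K).mpr h1⟩,
    ⟨_, (mem_integralClosure_iff ℤ K).mpr h2⟩, ⟨_, (mem_integralClosure_iff ℤ K).mpr h3⟩,
    rfl, rfl, rfl, rfl⟩

/-- **`I³ = δ · J`**: `(θ₁, θ₂)³ = (θ₁θ₂) · (θ₀, θ₁, θ₂, θ₃)` — the system (21) read as an identity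
of ideals (`α³ = δθ₀, α²β = δθ₁, αβ² = δθ₂, β³ = δθ₃`). [cite: Bhargava2004HCL1, §3.4 (proof of Theorem 13: I³ ⊆ δ·S via (21))] -/
theorem cubicIdeal_pow_three_eq_mul : C.cubicIdeal s ^ 3 = C.deltaIdeal s * C.thetaSpan s := by
  obtain ⟨t₀, t₁, t₂, t₃, ht₀, ht₁, ht₂, ht₃⟩ := exists_ringOfIntegers_thetaForm C hs hε h4
  rw [cubicIdeal_eq_span C ht₁ ht₂, deltaIdeal_eq_span C ht₁ ht₂,
    thetaSpan_eq_span C ht₀ ht₁ ht₂ ht₃]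
  -- the four relations in `𝓞 K`
  have h02 := thetaForm_a₀_mul_a₂ C hs
  have h13 := thetaForm_a₁_mul_a₃ C hs
  have r0 : t₁ ^ 3 = t₁ * t₂ * t₀ := by
    apply RingOfIntegers.coe_injective
    simp only [map_pow, map_mul]
    rw [← RingOfIntegers.coe_eq_algebraMap t₀, ← RingOfIntegers.coe_eq_algebraMap t₁,
      ← RingOfIntegers.coe_eq_algebraMap t₂, ht₀, ht₁, ht₂]
    exact thetaForm_a₁_pow_three C hs
  have r1 : t₁ ^ 2 * t₂ = t₁ * t₂ * t₁ := by ring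
  have r2 : t₁ * t₂ ^ 2 = t₁ * t₂ * t₂ := by ring
  have r3 : t₂ ^ 3 = t₁ * t₂ * t₃ := by
    apply RingOfIntegers.coe_injective
    simp only [map_pow, map_mul]
    rw [← RingOfIntegers.coe_eq_algebraMap t₁, ← RingOfIntegers.coe_eq_algebraMap t₂,
      ← RingOfIntegers.coe_eq_algebraMap t₃, ht₁, ht₂, ht₃]
    exact thetaForm_a₂_pow_three C hs
  apply le_antisymm
  · -- `I³ ≤ δ J`: generators of `I³`
    rw [show (3 : ℕ) = 2 + 1 by rfl, pow_succ, pow_two]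
    refine Ideal.mul_le.mpr fun x hx y hy => ?_
    refine Submodule.mul_induction_on hx (fun u hu v hv => ?_) (fun u v hu hv => ?_)
    · rw [Ideal.mem_span_pair] at hu hv hy
      obtain ⟨a₁, b₁, rfl⟩ := hu
      obtain ⟨a₂, b₂, rfl⟩ := hv
      obtain ⟨a₃, b₃, rfl⟩ := hy
      have key : (a₁ * t₁ + b₁ * t₂) * (a₂ * t₁ + b₂ * t₂) * (a₃ * t₁ + b₃ * t₂)
          = (t₁ * t₂) * ((a₁ * a₂ * a₃) * t₀ + (a₁ * a₂ * b₃ + a₁ * b₂ * a₃ + b₁ * a₂ * a₃) * t₁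
              + (a₁ * b₂ * b₃ + b₁ * a₂ * b₃ + b₁ * b₂ * a₃) * t₂ + (b₁ * b₂ * b₃) * t₃) := by
        linear_combination (a₁ * a₂ * a₃) * r0 + (b₁ * b₂ * b₃) * r3
      rw [key]
      refine Ideal.mul_mem_mul (Ideal.subset_span rfl) ?_
      refine Ideal.add_mem _ (Ideal.add_mem _ (Ideal.add_mem _ ?_ ?_) ?_) ?_
      · exact Ideal.mul_mem_left _ _ (Ideal.subset_span (by simp))
      · exact Ideal.mul_mem_left _ _ (Ideal.subset_span (by simp))
      · exact Ideal.mul_mem_left _ _ (Ideal.subset_span (by simp))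
      · exact Ideal.mul_mem_left _ _ (Ideal.subset_span (by simp))
    · rw [add_mul]
      exact Ideal.add_mem _ hu hv
  · -- `δ J ≤ I³`: `δ tᵢ` is a product of three generators
    refine Ideal.mul_le.mpr fun x hx y hy => ?_
    rw [Ideal.mem_span_singleton] at hx
    obtain ⟨c, rfl⟩ := hx
    rw [mul_comm _ c, mul_assoc]
    refine Ideal.mul_mem_left _ c ?_
    have hI1 : t₁ ∈ Ideal.span ({t₁, t₂} : Set (𝓞 K)) := Ideal.subset_span (by simp)
    have hI2 : t₂ ∈ Ideal.span ({t₁, t₂} : Set (𝓞 K)) := Ideal.subset_span (by simp)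
    have cube : ∀ u v w, u ∈ Ideal.span ({t₁, t₂} : Set (𝓞 K)) → v ∈ Ideal.span ({t₁, t₂} : Set (𝓞 K)) →
        w ∈ Ideal.span ({t₁, t₂} : Set (𝓞 K)) → u * v * w ∈ Ideal.span ({t₁, t₂} : Set (𝓞 K)) ^ 3 := by
      intro u v w hu hv hw
      rw [show (3 : ℕ) = 2 + 1 by rfl, pow_succ, pow_two]
      exact Ideal.mul_mem_mul (Ideal.mul_mem_mul hu hv) hw
    -- decompose `y` over the four generators
    refine Submodule.span_induction (p := fun y _ => t₁ * t₂ * y ∈ Ideal.span {t₁, t₂} ^ 3) ?_ ?_ ?_ ?_ hy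
    · intro y hy'
      simp only [Set.mem_insert_iff, Set.mem_singleton_iff] at hy'
      rcases hy' with h | h | h | h <;> rw [h]
      · rw [← r0, show t₁ ^ 3 = t₁ * t₁ * t₁ by ring]; exact cube _ _ _ hI1 hI1 hI1
      · rw [← r1, show t₁ ^ 2 * t₂ = t₁ * t₁ * t₂ by ring]; exact cube _ _ _ hI1 hI1 hI2
      · rw [← r2, show t₁ * t₂ ^ 2 = t₁ * t₂ * t₂ by ring]; exact cube _ _ _ hI1 hI2 hI2
      · rw [← r3, show t₂ ^ 3 = t₂ * t₂ * t₂ by ring]; exact cube _ _ _ hI2 hI2 hI2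
    · simp
    · intro u v _ _ hu hv
      rw [mul_add]
      exact Ideal.add_mem _ hu hv
    · intro c u _ hu
      rw [smul_eq_mul, mul_left_comm]
      exact Ideal.mul_mem_left _ c hu

/-- **`J = (θ₀, θ₁, θ₂, θ₃) = 𝓞 K` for projective `C`**: if the Hessian `(A, B, C)` is primitive then
`1 ∈ J`, since `J` contains the integers `A² = −(a₀θ₁ − a₁θ₀)`, `AB`, `B² = (AC − (AC − B²))`,
`C²` (Bhargava–Varma (9): projectivity ⟺ `(A, B, C) = 1`; here only the direction used for
`I³ = (δ)`). [cite: BhargavaVarma2016, §2.3 (9)] -/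
theorem thetaSpan_eq_top (hprim : Int.gcd (Int.gcd C.hess.1 C.hess.2.1) C.hess.2.2 = 1) :
    C.thetaSpan s = ⊤ := by
  obtain ⟨t₀, t₁, t₂, t₃, ht₀, ht₁, ht₂, ht₃⟩ := exists_ringOfIntegers_thetaForm C hs hε h4
  rw [thetaSpan_eq_span C ht₀ ht₁ ht₂ ht₃, Ideal.eq_top_iff_one]
  set J : Ideal (𝓞 K) := Ideal.span {t₀, t₁, t₂, t₃} with hJ
  have m0 : t₀ ∈ J := Ideal.subset_span (by simp)
  have m1 : t₁ ∈ J := Ideal.subset_span (by simp)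
  have m2 : t₂ ∈ J := Ideal.subset_span (by simp)
  have m3 : t₃ ∈ J := Ideal.subset_span (by simp)
  set A := C.hess.1 with hA
  set B := C.hess.2.1 with hB
  set Cc := C.hess.2.2 with hCc
  -- the integer combinations, in `𝓞 K`
  have coe_eq : ∀ {n : ℤ} {a b : ℤ} {u v : 𝓞 K} {x y : K}, (u : K) = x → (v : K) = y →
      (a : K) * x - (b : K) * y = (n : K) → ((n : ℤ) : 𝓞 K) = (a : 𝓞 K) * u - (b : 𝓞 K) * v := by
    intro n a b u v x y hu hv h
    apply RingOfIntegers.coe_injective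
    simp only [map_mul, map_sub, map_intCast]
    rw [← RingOfIntegers.coe_eq_algebraMap u, ← RingOfIntegers.coe_eq_algebraMap v, hu, hv]
    exact h.symm
  have eA : ((-(A ^ 2) : ℤ) : 𝓞 K) = (C.a₀ : 𝓞 K) * t₁ - (C.a₁ : 𝓞 K) * t₀ :=
    coe_eq ht₁ ht₀ (by rw [a₀_mul_theta₁_sub]; push_cast; ring)
  have eAB : ((A * B : ℤ) : 𝓞 K) = (C.a₀ : 𝓞 K) * t₂ - (C.a₂ : 𝓞 K) * t₀ :=
    coe_eq ht₂ ht₀ (by rw [a₀_mul_theta₂_sub]; push_cast; ring)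
  have eACB : ((A * Cc - B ^ 2 : ℤ) : 𝓞 K) = (C.a₀ : 𝓞 K) * t₃ - (C.a₃ : 𝓞 K) * t₀ :=
    coe_eq ht₃ ht₀ (by rw [a₀_mul_theta₃_sub]; push_cast; ring)
  have eAC : ((-(A * Cc) : ℤ) : 𝓞 K) = (C.a₁ : 𝓞 K) * t₂ - (C.a₂ : 𝓞 K) * t₁ :=
    coe_eq ht₂ ht₁ (by rw [a₁_mul_theta₂_sub]; push_cast; ring)
  have eC : ((-(Cc ^ 2) : ℤ) : 𝓞 K) = (C.a₂ : 𝓞 K) * t₃ - (C.a₃ : 𝓞 K) * t₂ :=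
    coe_eq ht₃ ht₂ (by rw [a₂_mul_theta₃_sub]; push_cast; ring)
  have sub_mem : ∀ (a b : ℤ) {u v : 𝓞 K}, u ∈ J → v ∈ J → (a : 𝓞 K) * u - (b : 𝓞 K) * v ∈ J :=
    fun a b u v hu hv => Ideal.sub_mem _ (Ideal.mul_mem_left _ _ hu) (Ideal.mul_mem_left _ _ hv)
  have neg_aux : ∀ {n : ℤ}, ((-n : ℤ) : 𝓞 K) ∈ J → ((n : ℤ) : 𝓞 K) ∈ J := by
    intro n hn
    have h' : -((n : ℤ) : 𝓞 K) ∈ J := by simpa [Int.cast_neg] using hn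
    simpa using J.neg_mem h'
  have iA : ((A ^ 2 : ℤ) : 𝓞 K) ∈ J := neg_aux (eA ▸ sub_mem C.a₀ C.a₁ m1 m0)
  have iAB : ((A * B : ℤ) : 𝓞 K) ∈ J := eAB ▸ sub_mem C.a₀ C.a₂ m2 m0
  have iAC : ((A * Cc : ℤ) : 𝓞 K) ∈ J := neg_aux (eAC ▸ sub_mem C.a₁ C.a₂ m2 m1)
  have iB : ((B ^ 2 : ℤ) : 𝓞 K) ∈ J := by
    have h1 := sub_mem C.a₀ C.a₃ m3 m0
    rw [← eACB] at h1
    have : ((B ^ 2 : ℤ) : 𝓞 K) = ((A * Cc : ℤ) : 𝓞 K) - ((A * Cc - B ^ 2 : ℤ) : 𝓞 K) := by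
      push_cast; ring
    rw [this]
    exact Ideal.sub_mem _ iAC h1
  have iC : ((Cc ^ 2 : ℤ) : 𝓞 K) ∈ J := neg_aux (eC ▸ sub_mem C.a₂ C.a₃ m3 m2)
  -- Bezout: `1 = x (aA + bB)² + y C²`
  set g : ℕ := Int.gcd A B with hg
  have hgab : (g : ℤ) = A * Int.gcdA A B + B * Int.gcdB A B := Int.gcd_eq_gcd_ab A B
  have hcop : IsCoprime (g : ℤ) Cc := Int.isCoprime_iff_gcd_eq_one.mpr hprim
  obtain ⟨x, y, hxy⟩ := hcop.pow (m := 2) (n := 2)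
  have key : (1 : 𝓞 K) = (x * Int.gcdA A B ^ 2 : ℤ) * ((A ^ 2 : ℤ) : 𝓞 K)
      + (2 * x * Int.gcdA A B * Int.gcdB A B : ℤ) * ((A * B : ℤ) : 𝓞 K)
      + (x * Int.gcdB A B ^ 2 : ℤ) * ((B ^ 2 : ℤ) : 𝓞 K) + (y : ℤ) * ((Cc ^ 2 : ℤ) : 𝓞 K) := by
    have h1 : ((1 : ℤ) : 𝓞 K) = ((x * (g : ℤ) ^ 2 + y * Cc ^ 2 : ℤ) : 𝓞 K) := by rw [hxy]
    rw [hgab] at h1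
    push_cast at h1 ⊢
    linear_combination h1
  rw [key]
  refine Ideal.add_mem _ (Ideal.add_mem _ (Ideal.add_mem _ ?_ ?_) ?_) ?_ <;>
    exact Ideal.mul_mem_left _ _ ‹_›

/-- **`(θ₁, θ₂)³ = (δ)` in `𝓞 K`** (`δ = θ₁θ₂`) for projective `C`: the extension to `𝓞 K` of
Bhargava–Varma §2.2, "if `I` is projective … we have `I³ = (δ)`" (an identity of `S`-ideals for
the triple attached to `C` by Thm 9 / HCL I Thm 13; it is literally that statement when `disc C`
is fundamental, `S = 𝓞 K`, and in general its image under `I ↦ I·𝓞 K`, proved here directly).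
[cite: BhargavaVarma2016, §2.2 (projective triples: I³ = (δ)); stated for the extended ideal in 𝓞 K] -/
theorem cubicIdeal_pow_three (hprim : Int.gcd (Int.gcd C.hess.1 C.hess.2.1) C.hess.2.2 = 1) :
    C.cubicIdeal s ^ 3 = C.deltaIdeal s := by
  rw [cubicIdeal_pow_three_eq_mul C hs hε h4, thetaSpan_eq_top C hs hε h4 hprim, Ideal.mul_top]

/-- `I ≠ 0` when `disc C` is not a square (`θ₁ ≠ 0`). [folklore] -/
theorem cubicIdeal_ne_bot (hD : ¬ IsSquare C.disc) : C.cubicIdeal s ≠ ⊥ := by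
  obtain ⟨t₀, t₁, t₂, t₃, ht₀, ht₁, ht₂, ht₃⟩ := exists_ringOfIntegers_thetaForm C hs hε h4
  rw [cubicIdeal_eq_span C ht₁ ht₂, Ne, Ideal.span_eq_bot]
  intro h
  have h1 : t₁ = 0 := h t₁ (by simp)
  have : (C.thetaForm s).a₁ = 0 := by rw [← ht₁, h1]; rfl
  exact thetaForm_a₁_ne_zero C hs hD this

/-- `(δ) ≠ 0` when `disc C` is not a square. [folklore] -/
theorem deltaIdeal_ne_bot (hD : ¬ IsSquare C.disc) : C.deltaIdeal s ≠ ⊥ := by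
  obtain ⟨t₀, t₁, t₂, t₃, ht₀, ht₁, ht₂, ht₃⟩ := exists_ringOfIntegers_thetaForm C hs hε h4
  rw [deltaIdeal_eq_span C ht₁ ht₂, Ne, Ideal.span_singleton_eq_bot]
  intro h
  have : (C.thetaForm s).a₁ * (C.thetaForm s).a₂ = 0 := by
    rw [← ht₁, ← ht₂, ← map_mul, h]; rfl
  exact thetaForm_a₁_mul_a₂_ne_zero C hs hD this

/-- **The 3-torsion ideal class of `C`**: for projective `C` of non-square discriminant,
`[(θ₁, θ₂)]³ = 1` in `Cl(𝓞 K)` (for fundamental `disc C` this is the map `C ↦ [I]`,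
`H(𝒪) → Cl₃(𝒪)` of Bhargava–Varma Lemma 13 / HCL I Cor. 14–15 with `𝒪 = 𝓞 K`; for
non-fundamental `disc C` it is the class of the extended ideal `I·𝓞 K`). [cite: BhargavaVarma2016, Lemma 13 (the forgetful map (𝒪, I, δ) ↦ [I] into Cl₃); here for the extended ideal in 𝓞 K] -/
theorem mk0_cubicIdeal_pow_three [NumberField K] (hprim : Int.gcd (Int.gcd C.hess.1 C.hess.2.1) C.hess.2.2 = 1)
    (hD : ¬ IsSquare C.disc) :
    ClassGroup.mk0 ⟨C.cubicIdeal s, mem_nonZeroDivisors_of_ne_zero (cubicIdeal_ne_bot C hs hε h4 hD)⟩ ^ 3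
      = 1 := by
  rw [← map_pow]
  have h3 : (⟨C.cubicIdeal s, mem_nonZeroDivisors_of_ne_zero (cubicIdeal_ne_bot C hs hε h4 hD)⟩ ^ 3 :
      (Ideal (𝓞 K))⁰) = ⟨C.deltaIdeal s, mem_nonZeroDivisors_of_ne_zero (deltaIdeal_ne_bot C hs hε h4 hD)⟩ := by
    apply Subtype.ext
    push_cast
    exact cubicIdeal_pow_three C hs hε h4 hprim
  rw [h3, ClassGroup.mk0_eq_one_iff]
  obtain ⟨t₀, t₁, t₂, t₃, ht₀, ht₁, ht₂, ht₃⟩ := exists_ringOfIntegers_thetaForm C hs hε h4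
  rw [deltaIdeal_eq_span C ht₁ ht₂]
  exact ⟨t₁ * t₂, rfl⟩

end Main

end SymCubic

end Literature.NumberTheory.CubicFields
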